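import Summits.CriticalPhenomena.PercolationContinuityZ3.Theorems.PercNearOneGluingNoHeavyQuantBlobWalkHead
import Summits.CriticalPhenomena.PercolationContinuityZ3.Theorems.PercNearOneGluingNoHeavyQuantFarTreeChainStep
import HarnessLib

/-!
# QUANT lane R8, FAR on trees: the law of the relay count on a BLOCK-COMB (gate coordinates) — the tree side of the
# blob-walk exchange calculus (`…QuantBlobWalk.lean`), LEAD-NOTES-G10 N21 (1)

builds on p205010 (kernel theorem, internal audit signed; external expert review pending)

Support file (`--supports stmt-CriticalPhenomena-4575`), QUANT lane typer seat prim-quant-stmt (gen 14), rung R8 of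
`run/shared/lean/prim/quant/LADDER.md`; asked for by the gen-10 lead (lane INBOX 2026-08-20T21:25Z (2)(i),
`prim-quant-lead-g10/LEAD-NOTES-G10.md` N21 (1) and the KERNEL ADDENDUM: "what is left … the TREE-SIDE identity (EX)").
Theorems only; no definitions (the `local notation3` `CB[a, p, m]` of `…QuantBlobWalk.lean`, verbatim), no sorries, standard axioms.

**Setting** (gate coordinates of `Quant.FarTreeRow`, generic finite gate type `ι`): ancestor finsets `P : ι → Finset ι`, independent
gates `prodBernoulli q`, relay `y` reached iff `↑(P y) ⊆ ω`, `N = #{y ∈ A : ↑(P y) ⊆ ω}`.  A BLOCK-COMB (P1-SURPLUS 17.6, N21 (0)) around the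
distinguished relay `a` (chain `P a`, weight `x = ∏_{P a} q`, terminal block `{y ∈ A | P y = P a}` of size `c`) is a relay set `A ∋ a` whose
other relays fall into BLOBS = fibres of `P`: finitely many distinct ancestor sets `Q 0, …, Q (K−1)` (`≠ P a`), listed ROOT-FIRST
(`Q k ∩ P a ⊆ Q k' ∩ P a` for `k ≤ k'`), with pairwise disjoint PRIVATE PARTS (`Q k ∩ Q k' ⊆ P a` for `k ≠ k'`); blob `k` has size
`sz k = #{y ∈ A | P y = Q k}`, private gate `p k = ∏_{Q k ∖ P a} q` and chain weight `w k = ∏_{Q k ∩ P a} q` (relays ON the chain are blobs with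
`p k = 1`; unit combs are `sz ≡ 1`, block-stars are `w ≡ 1`).  With `S_k` = open mass of the first `k` blobs and `CB[sz, p, k] t = P(S_k ≤ t)`
(the recursion of `…QuantBlobWalk.lean`):

* `Quant.card_filter_reached_split_fiber` — `N = N' + sz 0 · 1[Q 0 open]` (remove one fibre).
* `Quant.blockComb_count_eq` — **the count law on a block-comb, every level `t ≥ 0`:**
  `P(N ≥ t+1) = Σ_{k<K} w k · p k · (CB[k] t − CB[k] (t − sz k)) + x · (CB[K] t − CB[K] (t − c))`
  ("crossing form": the level `t+1` is crossed at blob `k` — chain open to it, blob open, prefix mass in the window `(t − sz k, t]` — or at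
  the terminal block).  Induction on `K` removing the TOP blob (its private part is independent of everything else, and any other reached
  relay forces its chain part open), as p1 g6's `Quant.comb_count_eq` for unit hairs; the algebra is `BlobWalk.crossing_form_head`
  (`…QuantBlobWalkHead.lean`, same seat).
* `Quant.blockComb_exchange_identity` — **N21 (1), the exchange form (EX):**
  `P(N ≥ t+1) − x = Σ_{k<K} (w k − x) · p k · (CB[k] t − CB[k] (t − sz k)) − x · CB[K] (t − c)` (`t ≥ 0`; crossing form + `CB_cross`).
  So the far-relay row at layer `j` for the block-comb (`P(N ≤ j) ≤ 1 − x`) IS the exchange inequality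
  `x · CB[K](j − c) ≤ Σ_k (w k − x) p k · window_k(j)` of `…QuantBlobWalk.lean` — see `…QuantFarTreeBlockComb.lean` (same seat) for the FAR
  corollaries (equal private gates via `BlobWalk.exchange_of_const'`; the prefix-window regime via `BlobWalk.exchange_of_prefixWindow`).
Exact re-check of both forms: `run/shared/lean/prim/quant/prim-quant-stmt-g14/code/check_blockcomb_identity.py` (2 400 rational instances,
brute force over configurations, 0 mismatches; the lead's `n21_checks.py` (2) checked (EX) on 1 500).  [this work] unless marked [folklore];
independence of disjointly supported events [cite: Grimmett1999, §2.2]; product measure [cite: Grimmett1999, §1.3 p. 10].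
-/

noncomputable section

namespace Summit.CriticalPhenomena.PercolationContinuityZ3.Theorems

namespace Quant

open Finset MeasureTheory
open Literature.Probability.LatticeModels
open Literature.Probability.Percolation
open scoped Classical

/-- `CB[a, p, m] t` = probability that the open mass of the first `m` blobs (sizes `a`, gates `p`) is `≤ t` (the recursion of
`…QuantBlobWalk.lean`, verbatim). -/
local notation3 "CB[" a ", " p ", " m "]" =>
  (Nat.rec (motive := fun _ => ℤ → ℝ) (fun t => if (0 : ℤ) ≤ t then (1 : ℝ) else 0)
    (fun n f t => (p : ℕ → ℝ) n * f (t - ((a : ℕ → ℕ) n : ℤ)) + (1 - (p : ℕ → ℝ) n) * f t) (m : ℕ))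


variable {ι : Type*}

/-! ### Removing one fibre of `P` from the relay count -/

/-- **One fibre removed.**  `#{y ∈ A : P y open} = #{y ∈ A, P y ≠ Q₀ : P y open} + 1[Q₀ open] · #{y ∈ A : P y = Q₀}`. [folklore] -/
theorem card_filter_reached_split_fiber [DecidableEq ι] (P : ι → Finset ι) (A : Finset ι) (Q₀ : Finset ι) (ω : Set ι) :
    (A.filter fun y => ((P y : Finset ι) : Set ι) ⊆ ω).card =
      ((A.filter fun y => P y ≠ Q₀).filter fun y => ((P y : Finset ι) : Set ι) ⊆ ω).card +
        (if ((Q₀ : Finset ι) : Set ι) ⊆ ω then (A.filter fun y => P y = Q₀).card else 0) := by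
  have hA : A = (A.filter fun y => P y ≠ Q₀) ∪ (A.filter fun y => P y = Q₀) := by
    ext y
    simp only [Finset.mem_union, Finset.mem_filter]
    tauto
  have hdisj : Disjoint ((A.filter fun y => P y ≠ Q₀).filter fun y => ((P y : Finset ι) : Set ι) ⊆ ω)
      ((A.filter fun y => P y = Q₀).filter fun y => ((P y : Finset ι) : Set ι) ⊆ ω) := by
    rw [Finset.disjoint_left]
    intro y hy hy'
    exact (Finset.mem_filter.1 (Finset.mem_filter.1 hy).1).2 (Finset.mem_filter.1 (Finset.mem_filter.1 hy').1).2
  conv_lhs => rw [hA]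
  rw [Finset.filter_union, Finset.card_union_of_disjoint hdisj]
  congr 1
  by_cases h : ((Q₀ : Finset ι) : Set ι) ⊆ ω
  · rw [if_pos h, Finset.filter_true_of_mem]
    intro y hy
    rw [(Finset.mem_filter.1 hy).2]; exact h
  · rw [if_neg h, Finset.card_eq_zero, Finset.filter_false_of_mem]
    intro y hy
    rw [(Finset.mem_filter.1 hy).2]; exact h

/-! ### The count law on a block-comb -/

section Count

variable [Fintype ι] [DecidableEq ι]

/-- **The count law on a block-comb (crossing form).**  See the file header.  Data: ancestor finsets `P`, gates `q`, distinguished relay `a`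
with `x = ∏_{P a} q`; relays `A ∋ a`; terminal size `c = #{y ∈ A | P y = P a}`; blobs `Q 0, …, Q (K−1)` (the distinct ancestor sets
`≠ P a` of the other relays: covering, injective), ROOT-FIRST (`Q k ∩ P a ⊆ Q k' ∩ P a`, `k ≤ k'`), with pairwise disjoint private parts
(`Q k ∩ Q k' ⊆ P a`, `k ≠ k'`), sizes `sz k = #{y ∈ A | P y = Q k}`, gates `p k = ∏_{Q k ∖ P a} q`, chain weights `w k = ∏_{Q k ∩ P a} q`.
Then for every `t ≥ 0`:
`P(#{y ∈ A : ↑(P y) ⊆ ω} ≥ t+1) = Σ_{k<K} w k · p k · (CB[sz,p,k] t − CB[sz,p,k] (t − sz k)) + x · (CB[sz,p,K] t − CB[sz,p,K] (t − c))`.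
[this work] -/
theorem blockComb_count_eq (P : ι → Finset ι) (q : ι → unitInterval) (a : ι) (x : ℝ) (hx : x = ∏ y ∈ P a, (q y : ℝ)) :
    ∀ (K : ℕ) (A : Finset ι) (Q : ℕ → Finset ι) (sz : ℕ → ℕ) (c : ℕ) (p w : ℕ → ℝ),
      a ∈ A →
      c = (A.filter fun y => P y = P a).card →
      (∀ k, k < K → sz k = (A.filter fun y => P y = Q k).card) →
      (∀ y ∈ A, P y = P a ∨ ∃ k, k < K ∧ P y = Q k) →
      (∀ k, k < K → Q k ≠ P a) →
      (∀ k k', k < K → k' < K → Q k = Q k' → k = k') →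
      (∀ k k', k ≤ k' → k' < K → Q k ∩ P a ⊆ Q k' ∩ P a) →
      (∀ k k', k < K → k' < K → k ≠ k' → Q k ∩ Q k' ⊆ P a) →
      (∀ k, p k = ∏ y ∈ Q k \ P a, (q y : ℝ)) →
      (∀ k, w k = ∏ y ∈ Q k ∩ P a, (q y : ℝ)) →
      ∀ t : ℤ, 0 ≤ t →
        (prodBernoulli q).real
            {ω : Set ι | t + 1 ≤ (((A.filter fun y => ((P y : Finset ι) : Set ι) ⊆ ω).card : ℕ) : ℤ)} =
          ∑ k ∈ Finset.range K, w k * p k * (CB[sz, p, k] t - CB[sz, p, k] (t - (sz k : ℤ))) +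
            x * (CB[sz, p, K] t - CB[sz, p, K] (t - (c : ℤ))) := by
  intro K
  induction K with
  | zero =>
    intro A Q sz c p w ha hc _ hcover _ _ _ _ _ _ t ht
    -- every relay is in the terminal block: `N = c · 1[P a open]`
    have hall : ∀ y ∈ A, P y = P a := fun y hy => by
      rcases hcover y hy with h | ⟨k, hk, _⟩
      · exact h
      · omega
    have hAc : A.card = c := by rw [hc, Finset.filter_true_of_mem hall]
    rw [Finset.sum_range_zero, zero_add]
    have hev : {ω : Set ι | t + 1 ≤ (((A.filter fun y => ((P y : Finset ι) : Set ι) ⊆ ω).card : ℕ) : ℤ)} =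
        if t + 1 ≤ (c : ℤ) then {ω : Set ι | ((P a : Finset ι) : Set ι) ⊆ ω} else ∅ := by
      ext ω
      simp only [Set.mem_setOf_eq]
      by_cases hPa : ((P a : Finset ι) : Set ι) ⊆ ω
      · have hN : (A.filter fun y => ((P y : Finset ι) : Set ι) ⊆ ω).card = c := by
          rw [Finset.filter_true_of_mem fun y hy => by rw [hall y hy]; exact hPa, hAc]
        rw [hN]
        split_ifs with h
        · simp only [Set.mem_setOf_eq]; exact ⟨fun _ => hPa, fun _ => h⟩
        · simp only [Set.mem_empty_iff_false, iff_false]; exact h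
      · have hN : (A.filter fun y => ((P y : Finset ι) : Set ι) ⊆ ω).card = 0 := by
          rw [Finset.card_eq_zero, Finset.filter_false_of_mem fun y hy => by rw [hall y hy]; exact hPa]
        rw [hN]
        split_ifs with h
        · simp only [Set.mem_setOf_eq, Nat.cast_zero]; exact ⟨fun h' => absurd h' (by omega), fun h' => absurd h' hPa⟩
        · simp only [Set.mem_empty_iff_false, iff_false, Nat.cast_zero]; omega
    rw [hev]
    -- the walk side: `CB[0] t − CB[0](t − c) = 1[t − c < 0]`
    rw [BlobWalk.CB_zero_of_nonneg sz p ht]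
    by_cases h : t + 1 ≤ (c : ℤ)
    · rw [if_pos h, prodBernoulli_real_subset, ← hx, BlobWalk.CB_zero_of_neg sz p (by omega)]; ring
    · rw [if_neg h, measureReal_empty, BlobWalk.CB_zero_of_nonneg sz p (by omega)]; ring
  | succ K ih =>
    intro A Q sz c p w ha hc hsz hcover hQne hinj hmono hdisj hpdef hwdef t ht
    set μ := prodBernoulli q with hμ
    have hmeas : ∀ T : Set (Set ι), MeasurableSet T := fun T => (Set.toFinite T).measurableSet
    -- the top blob `Q 0` and the reduced block-comb
    set A' : Finset ι := A.filter fun y => P y ≠ Q 0 with hA'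
    have hQ0 : Q 0 ≠ P a := hQne 0 (by omega)
    have haA' : a ∈ A' := Finset.mem_filter.2 ⟨ha, hQ0.symm⟩
    have hc' : c = (A'.filter fun y => P y = P a).card := by
      rw [hc]; congr 1; ext y; simp only [hA', Finset.mem_filter]
      exact ⟨fun ⟨hy, hP⟩ => ⟨⟨hy, by rw [hP]; exact hQ0.symm⟩, hP⟩, fun ⟨⟨hy, _⟩, hP⟩ => ⟨hy, hP⟩⟩
    have hsz' : ∀ k, k < K → (fun k => sz (k + 1)) k = (A'.filter fun y => P y = (fun k => Q (k + 1)) k).card := by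
      intro k hk
      simp only
      rw [hsz (k + 1) (by omega)]
      congr 1; ext y; simp only [hA', Finset.mem_filter]
      refine ⟨fun ⟨hy, hP⟩ => ⟨⟨hy, ?_⟩, hP⟩, fun ⟨⟨hy, _⟩, hP⟩ => ⟨hy, hP⟩⟩
      rw [hP]
      exact fun h => by have := hinj (k + 1) 0 (by omega) (by omega) h; omega
    have hcover' : ∀ y ∈ A', P y = P a ∨ ∃ k, k < K ∧ P y = (fun k => Q (k + 1)) k := by
      intro y hy
      obtain ⟨hyA, hyQ⟩ := Finset.mem_filter.1 hy
      rcases hcover y hyA with h | ⟨k, hk, hky⟩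
      · exact Or.inl h
      · cases k with
        | zero => exact absurd hky hyQ
        | succ k => exact Or.inr ⟨k, by omega, hky⟩
    have hQne' : ∀ k, k < K → (fun k => Q (k + 1)) k ≠ P a := fun k hk => hQne (k + 1) (by omega)
    have hinj' : ∀ k k', k < K → k' < K → (fun k => Q (k + 1)) k = (fun k => Q (k + 1)) k' → k = k' := by
      intro k k' hk hk' h
      have := hinj (k + 1) (k' + 1) (by omega) (by omega) h
      omega
    have hmono' : ∀ k k', k ≤ k' → k' < K → (fun k => Q (k + 1)) k ∩ P a ⊆ (fun k => Q (k + 1)) k' ∩ P a :=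
      fun k k' hkk' hk' => hmono (k + 1) (k' + 1) (by omega) (by omega)
    have hdisj' : ∀ k k', k < K → k' < K → k ≠ k' → (fun k => Q (k + 1)) k ∩ (fun k => Q (k + 1)) k' ⊆ P a :=
      fun k k' hk hk' hne => hdisj (k + 1) (k' + 1) (by omega) (by omega) (by omega)
    have hpdef' : ∀ k, (fun k => p (k + 1)) k = ∏ y ∈ (fun k => Q (k + 1)) k \ P a, (q y : ℝ) := fun k => hpdef (k + 1)
    have hwdef' : ∀ k, (fun k => w (k + 1)) k = ∏ y ∈ (fun k => Q (k + 1)) k ∩ P a, (q y : ℝ) := fun k => hwdef (k + 1)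
    have IH := ih A' (fun k => Q (k + 1)) (fun k => sz (k + 1)) c (fun k => p (k + 1)) (fun k => w (k + 1)) haA' hc' hsz'
      hcover' hQne' hinj' hmono' hdisj' hpdef' hwdef'
    -- events
    set N : Set ι → ℕ := fun ω => (A.filter fun y => ((P y : Finset ι) : Set ι) ⊆ ω).card with hN
    set N' : Set ι → ℕ := fun ω => (A'.filter fun y => ((P y : Finset ι) : Set ι) ⊆ ω).card with hN'
    set J : Set (Set ι) := {ω | ((Q 0 \ P a : Finset ι) : Set ι) ⊆ ω} with hJ
    set ED : Set (Set ι) := {ω | ((Q 0 ∩ P a : Finset ι) : Set ι) ⊆ ω} with hED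
    -- pointwise structure
    have hQ0split : Q 0 = (Q 0 ∩ P a) ∪ (Q 0 \ P a) := by
      ext y; simp only [Finset.mem_union, Finset.mem_inter, Finset.mem_sdiff]; tauto
    have hreach₀ : ∀ ω : Set ι, ((Q 0 : Finset ι) : Set ι) ⊆ ω ↔
        (((Q 0 ∩ P a : Finset ι) : Set ι) ⊆ ω ∧ ((Q 0 \ P a : Finset ι) : Set ι) ⊆ ω) := by
      intro ω
      conv_lhs => rw [hQ0split]
      rw [Finset.coe_union, Set.union_subset_iff]
    have hNsplit : ∀ ω, N ω = N' ω + (if ((Q 0 : Finset ι) : Set ι) ⊆ ω then sz 0 else 0) := by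
      intro ω
      have h := card_filter_reached_split_fiber P A (Q 0) ω
      rw [← hsz 0 (by omega)] at h
      exact h
    -- every other relay's ancestor set contains the chain part of the top blob
    have hD₀sub : ∀ y ∈ A', Q 0 ∩ P a ⊆ P y := by
      intro y hy
      rcases hcover' y hy with h | ⟨k, hk, hky⟩
      · rw [h]; exact Finset.inter_subset_right
      · have h1 : Q 0 ∩ P a ⊆ Q (k + 1) ∩ P a := hmono 0 (k + 1) (by omega) (by omega)
        simp only at hky
        rw [hky]
        exact h1.trans Finset.inter_subset_left
    have hN'D : ∀ ω, 1 ≤ N' ω → ((Q 0 ∩ P a : Finset ι) : Set ι) ⊆ ω := by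
      intro ω h
      obtain ⟨y, hy⟩ := Finset.card_pos.1 (by simpa [hN'] using h)
      rw [Finset.mem_filter] at hy
      exact (Finset.coe_subset.2 (hD₀sub y hy.1)).trans hy.2
    -- supports: the private part of the top blob is disjoint from everything read by `N'` and by `ED`
    set F' : Finset ι := A'.biUnion P with hF'
    have hdisjF : Disjoint F' (Q 0 \ P a) := by
      rw [hF', Finset.disjoint_biUnion_left]
      intro y hy
      rw [Finset.disjoint_left]
      intro z hzy hzI
      rw [Finset.mem_sdiff] at hzI
      rcases hcover' y hy with h | ⟨k, hk, hky⟩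
      · rw [h] at hzy; exact hzI.2 hzy
      · simp only at hky
        rw [hky] at hzy
        have : z ∈ Q (k + 1) ∩ Q 0 := Finset.mem_inter.2 ⟨hzy, hzI.1⟩
        exact hzI.2 (hdisj (k + 1) 0 (by omega) (by omega) (by omega) this)
    have hPa_sub : P a ⊆ F' := Finset.subset_biUnion_of_mem P haA'
    have dN' : ∀ Φ : ℕ → Prop, DeterminedBy {ω : Set ι | Φ (N' ω)} (↑F' : Set ι) := fun Φ =>
      determinedBy_card_filter_open A' P F' (fun y hy => Finset.subset_biUnion_of_mem P hy) Φ
    have dJ : DeterminedBy J (↑(Q 0 \ P a) : Set ι) := determinedBy_subset_open (Q 0 \ P a)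
    have dED : DeterminedBy ED (↑F' : Set ι) :=
      (determinedBy_subset_open (Q 0 ∩ P a)).mono (Finset.coe_subset.2 (Finset.inter_subset_right.trans hPa_sub))
    have hPJ : μ.real J = p 0 := by rw [hJ, prodBernoulli_real_subset, hpdef 0]
    have hPEDJ : μ.real (ED ∩ J) = w 0 * p 0 := by
      rw [prodBernoulli_real_inter_of_determinedBy_disjoint q hdisjF dED dJ (hmeas _) (hmeas _), hED, hJ,
        prodBernoulli_real_subset, prodBernoulli_real_subset, hwdef 0, hpdef 0]
    have hindep : ∀ Φ : ℕ → Prop, μ.real ({ω | Φ (N' ω)} ∩ J) = μ.real {ω | Φ (N' ω)} * p 0 := by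
      intro Φ
      rw [prodBernoulli_real_inter_of_determinedBy_disjoint q hdisjF (dN' Φ) dJ (hmeas _) (hmeas _), hPJ]
    have hsplit : ∀ E : Set (Set ι), μ.real E = μ.real (E ∩ J) + μ.real (E \ J) := fun E =>
      (measureReal_inter_add_sdiff (μ := μ) (s := E) (hmeas _)).symm
    -- off `J` the top blob is not reached and `N = N'`
    have hoffJ : ∀ s : ℤ, {ω | s ≤ ((N ω : ℕ) : ℤ)} \ J = {ω | s ≤ ((N' ω : ℕ) : ℤ)} \ J := by
      intro s
      ext ω
      simp only [Set.mem_sdiff, Set.mem_setOf_eq, hJ]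
      constructor
      · rintro ⟨h, hJω⟩
        refine ⟨?_, hJω⟩
        have hnr : ¬ ((Q 0 : Finset ι) : Set ι) ⊆ ω := fun hr => hJω ((hreach₀ ω).1 hr).2
        have := hNsplit ω
        rw [if_neg hnr, add_zero] at this
        rw [← this]; exact h
      · rintro ⟨h, hJω⟩
        refine ⟨?_, hJω⟩
        have := hNsplit ω
        have hle : N' ω ≤ N ω := by rw [this]; omega
        exact h.trans (by exact_mod_cast hle)
    have hoffJ' : ∀ s : ℤ, μ.real ({ω | s ≤ ((N ω : ℕ) : ℤ)} \ J) = (1 - p 0) * μ.real {ω | s ≤ ((N' ω : ℕ) : ℤ)} := by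
      intro s
      rw [hoffJ s]
      have h1 := hsplit {ω | s ≤ ((N' ω : ℕ) : ℤ)}
      have h2 := hindep (fun n => s ≤ ((n : ℕ) : ℤ))
      rw [h2] at h1
      linarith
    -- on `J`: if the top blob is big (`t < sz 0`) the event is `ED`, otherwise it is `{N' ≥ t + 1 − sz 0}`
    have honJ_big : t < (sz 0 : ℤ) → {ω | t + 1 ≤ ((N ω : ℕ) : ℤ)} ∩ J = ED ∩ J := by
      intro hbig
      ext ω
      simp only [Set.mem_inter_iff, Set.mem_setOf_eq, hJ, hED]
      constructor
      · rintro ⟨h, hJω⟩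
        refine ⟨?_, hJω⟩
        by_cases hr : ((Q 0 : Finset ι) : Set ι) ⊆ ω
        · exact ((hreach₀ ω).1 hr).1
        · have := hNsplit ω
          rw [if_neg hr, add_zero] at this
          refine hN'D ω ?_
          have h' : (1 : ℤ) ≤ ((N' ω : ℕ) : ℤ) := by rw [← this]; omega
          exact_mod_cast h'
      · rintro ⟨hD, hJω⟩
        refine ⟨?_, hJω⟩
        have hreach : ((Q 0 : Finset ι) : Set ι) ⊆ ω := (hreach₀ ω).2 ⟨hD, hJω⟩
        have := hNsplit ω
        rw [if_pos hreach] at this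
        have hle : sz 0 ≤ N ω := by rw [this]; omega
        have hle' : ((sz 0 : ℕ) : ℤ) ≤ ((N ω : ℕ) : ℤ) := by exact_mod_cast hle
        omega
    have honJ_small : (sz 0 : ℤ) ≤ t →
        {ω | t + 1 ≤ ((N ω : ℕ) : ℤ)} ∩ J = {ω | t + 1 - (sz 0 : ℤ) ≤ ((N' ω : ℕ) : ℤ)} ∩ J := by
      intro hsmall
      ext ω
      simp only [Set.mem_inter_iff, Set.mem_setOf_eq, hJ]
      constructor
      · rintro ⟨h, hJω⟩
        refine ⟨?_, hJω⟩
        have := hNsplit ω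
        have hle : N ω ≤ N' ω + sz 0 := by rw [this]; split_ifs <;> omega
        have hle' : ((N ω : ℕ) : ℤ) ≤ ((N' ω : ℕ) : ℤ) + ((sz 0 : ℕ) : ℤ) := by exact_mod_cast hle
        omega
      · rintro ⟨h, hJω⟩
        refine ⟨?_, hJω⟩
        have h1 : (1 : ℤ) ≤ ((N' ω : ℕ) : ℤ) := by omega
        have hD := hN'D ω (by exact_mod_cast h1)
        have hreach : ((Q 0 : Finset ι) : Set ι) ⊆ ω := (hreach₀ ω).2 ⟨hD, hJω⟩
        have := hNsplit ω
        rw [if_pos hreach] at this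
        have heq : ((N ω : ℕ) : ℤ) = ((N' ω : ℕ) : ℤ) + ((sz 0 : ℕ) : ℤ) := by rw [this]; push_cast; ring
        omega
    -- assemble
    rw [BlobWalk.crossing_form_head sz p w x K c t]
    show μ.real {ω | t + 1 ≤ ((N ω : ℕ) : ℤ)} = _
    rw [hsplit {ω | t + 1 ≤ ((N ω : ℕ) : ℤ)}, hoffJ' (t + 1)]
    have IHt := IH t ht
    by_cases hbig : t < (sz 0 : ℤ)
    · -- big top blob
      rw [honJ_big hbig, hPEDJ, BlobWalk.CB_zero_of_nonneg sz p ht, BlobWalk.CB_zero_of_neg sz p (by omega : t - (sz 0 : ℤ) < 0),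
        BlobWalk.crossing_form_of_neg (fun i => sz (i + 1)) (fun i => p (i + 1)) (fun i => w (i + 1)) x K c
          (t - (sz 0 : ℤ)) (by omega)]
      change _ = _ + _ + (1 - p 0) * (∑ k ∈ Finset.range K, w (k + 1) * p (k + 1) *
          (CB[(fun i => sz (i + 1)), (fun i => p (i + 1)), k] t -
            CB[(fun i => sz (i + 1)), (fun i => p (i + 1)), k] (t - (sz (k + 1) : ℤ))) +
        x * (CB[(fun i => sz (i + 1)), (fun i => p (i + 1)), K] t -
          CB[(fun i => sz (i + 1)), (fun i => p (i + 1)), K] (t - (c : ℤ))))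
      rw [← IHt]
      ring
    · -- small top blob
      have hsmall : (sz 0 : ℤ) ≤ t := not_lt.1 hbig
      have IHs := IH (t - (sz 0 : ℤ)) (by omega)
      rw [honJ_small hsmall, hindep (fun n => t + 1 - (sz 0 : ℤ) ≤ ((n : ℕ) : ℤ)),
        BlobWalk.CB_zero_of_nonneg sz p ht, BlobWalk.CB_zero_of_nonneg sz p (by omega : (0 : ℤ) ≤ t - (sz 0 : ℤ))]
      simp only
      have e1 : {ω : Set ι | t + 1 - (sz 0 : ℤ) ≤ ((N' ω : ℕ) : ℤ)} = {ω : Set ι | t - (sz 0 : ℤ) + 1 ≤ ((N' ω : ℕ) : ℤ)} := by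
        ext ω; simp only [Set.mem_setOf_eq]; omega
      rw [e1]
      change (prodBernoulli q).real {ω : Set ι | t - (sz 0 : ℤ) + 1 ≤
          ((((A'.filter fun y => ((P y : Finset ι) : Set ι) ⊆ ω).card : ℕ) : ℕ) : ℤ)} * p 0 +
          (1 - p 0) * (prodBernoulli q).real {ω : Set ι | t + 1 ≤
            ((((A'.filter fun y => ((P y : Finset ι) : Set ι) ⊆ ω).card : ℕ) : ℕ) : ℤ)} = _
      rw [IHs, IHt]
      ring

/-- **The exchange form (EX), LEAD-NOTES-G10 N21 (1).**  Same data as `blockComb_count_eq`, gates `p k ∈ [0,1]` read off `q`; for every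
`t ≥ 0`:  `P(N ≥ t+1) − x = Σ_{k<K} (w k − x) · p k · (CB[k] t − CB[k] (t − sz k)) − x · CB[K] (t − c)`.
Hence the far-relay row at layer `j` for this block-comb, `P(N ≤ j) ≤ 1 − x`, is EQUIVALENT to the exchange inequality
`x · CB[K](j − c) ≤ Σ_k (w k − x) · p k · window_k(j)` of `…QuantBlobWalk.lean`. [this work] -/
theorem blockComb_exchange_identity (P : ι → Finset ι) (q : ι → unitInterval) (a : ι) (x : ℝ) (hx : x = ∏ y ∈ P a, (q y : ℝ))
    (K : ℕ) (A : Finset ι) (Q : ℕ → Finset ι) (sz : ℕ → ℕ) (c : ℕ) (p w : ℕ → ℝ)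
    (ha : a ∈ A) (hc : c = (A.filter fun y => P y = P a).card)
    (hsz : ∀ k, k < K → sz k = (A.filter fun y => P y = Q k).card)
    (hcover : ∀ y ∈ A, P y = P a ∨ ∃ k, k < K ∧ P y = Q k)
    (hQne : ∀ k, k < K → Q k ≠ P a)
    (hinj : ∀ k k', k < K → k' < K → Q k = Q k' → k = k')
    (hmono : ∀ k k', k ≤ k' → k' < K → Q k ∩ P a ⊆ Q k' ∩ P a)
    (hdisj : ∀ k k', k < K → k' < K → k ≠ k' → Q k ∩ Q k' ⊆ P a)
    (hpdef : ∀ k, p k = ∏ y ∈ Q k \ P a, (q y : ℝ))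
    (hwdef : ∀ k, w k = ∏ y ∈ Q k ∩ P a, (q y : ℝ)) (t : ℤ) (ht : 0 ≤ t) :
    (prodBernoulli q).real
        {ω : Set ι | t + 1 ≤ (((A.filter fun y => ((P y : Finset ι) : Set ι) ⊆ ω).card : ℕ) : ℤ)} - x =
      ∑ k ∈ Finset.range K, (w k - x) * p k * (CB[sz, p, k] t - CB[sz, p, k] (t - (sz k : ℤ))) -
        x * CB[sz, p, K] (t - (c : ℤ)) := by
  rw [blockComb_count_eq P q a x hx K A Q sz c p w ha hc hsz hcover hQne hinj hmono hdisj hpdef hwdef t ht]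
  -- `x · Σ_k p k · window_k(t) = x · (CB[0] t − CB[K] t) = x · (1 − CB[K] t)` (`CB_cross`)
  have hcross := BlobWalk.CB_cross sz p K t
  rw [BlobWalk.CB_zero_of_nonneg sz p ht] at hcross
  have e1 : ∑ k ∈ Finset.range K, (w k - x) * p k * (CB[sz, p, k] t - CB[sz, p, k] (t - (sz k : ℤ))) =
      ∑ k ∈ Finset.range K, w k * p k * (CB[sz, p, k] t - CB[sz, p, k] (t - (sz k : ℤ))) -
        x * ∑ k ∈ Finset.range K, p k * (CB[sz, p, k] t - CB[sz, p, k] (t - (sz k : ℤ))) := by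
    rw [Finset.mul_sum, ← Finset.sum_sub_distrib]
    exact Finset.sum_congr rfl fun k _ => by ring
  rw [e1, ← hcross]
  ring

end Count

end Quant

end Summit.CriticalPhenomena.PercolationContinuityZ3.Theorems

end
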